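import Mathlib

/-!
# Solo (blind) rung s17: the algebraic and calculus cores of the monotonicity-formula template

Soloist report `sharpest.md` v17 §2.10 / §4.14, work note `work/c69_monotonicity/M.md` (claims C69–C73).

THEOREM M of the report says that no SLICE functional `Θ(R) = R^α ∫ G(u,∇u)(·, t₀ - R²) w((· - x₀)/R)`
with a density `G` even under `u ↦ -u` is scale-monotone along all smooth solutions of 3D
Navier–Stokes (so the Struwe / Huisken analogues — Gaussian-windowed scaled energy, enstrophy,
`|ω|²`, `|S|²`, `|u|^q` — all fail), and that a surviving density must have a dominating component
even in `u` and odd in `∇u`.  Two finite-dimensional steps of that proof are formalised here: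

* `topOrder_nonpos_of_forall_amplitude` : the AMPLITUDE step — if `λ^(m+1) E + λ^m W ≤ 0` for all
  `λ > 0` then `E ≤ 0` (the top Euler order of `dΘ/dR` at the data slice must be one-signed);
* `dominance_of_four_parities` : the PARITY step — the four inequalities obtained from the data
  `u₀, -u₀, Pu₀, -Pu₀` force the `(𝔰-odd, 𝔭-even)` component `c` to be `≤ 0` and to dominate
  `|a|, |b|, |d|`; `even_density_rates_vanish` is the corollary used for 𝔰-even densities.

PROPOSITION G of the report is the backward-heat-kernel scaled-energy identity
`r dΘ_E/dr = 2Θ_E + 2Θ_D + Θ_F`; its calculus skeleton `d/dr [r² e(t₀ - r²)] = 2 r e - 2 r³ e'`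
is `scaledEnergy_hasDerivAt`, and the two elementary inequalities used in COROLLARY G1 (the
signed-flux criterion under type I) are `flux_criterion_step` and `sqrt_mul_add_div_le`.
No PDE is formalised; these are the checkable finite-dimensional cores only.
-/

set_option linter.dupNamespace false

namespace Summit.NavierStokesRegularity.NavierStokesRegularity.Theorems

/-- AMPLITUDE STEP. If `λ^(m+1) * E + λ^m * W ≤ 0` for every `λ > 0`, then `E ≤ 0`. -/
theorem topOrder_nonpos_of_forall_amplitude (m : ℕ) (E W : ℝ)
    (h : ∀ lam : ℝ, 0 < lam → lam ^ (m + 1) * E + lam ^ m * W ≤ 0) : E ≤ 0 := by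
  by_contra hE
  push Not at hE
  -- choose lam large: lam = (|W| + 1) / E
  set lam : ℝ := (|W| + 1) / E with hlam
  have hlam_pos : 0 < lam := by
    rw [hlam]; positivity
  have hpow : 0 < lam ^ m := pow_pos hlam_pos m
  have key := h lam hlam_pos
  -- lam^(m+1) E + lam^m W = lam^m (lam E + W) = lam^m (|W| + 1 + W) > 0
  have hlamE : lam * E = |W| + 1 := by
    rw [hlam]; field_simp
  have : lam ^ (m + 1) * E + lam ^ m * W = lam ^ m * (lam * E + W) := by ring
  rw [this, hlamE] at key
  have hpos : 0 < |W| + 1 + W := by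
    have := neg_abs_le W
    linarith
  have : 0 < lam ^ m * (|W| + 1 + W) := mul_pos hpow hpos
  linarith

/-- The mirror statement (monotone nonincreasing case): `0 ≤ λ^(m+1) E + λ^m W` for all `λ > 0`
forces `0 ≤ E`. -/
theorem topOrder_nonneg_of_forall_amplitude (m : ℕ) (E W : ℝ)
    (h : ∀ lam : ℝ, 0 < lam → 0 ≤ lam ^ (m + 1) * E + lam ^ m * W) : 0 ≤ E := by
  have h' : ∀ lam : ℝ, 0 < lam → lam ^ (m + 1) * (-E) + lam ^ m * (-W) ≤ 0 := by
    intro lam hl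
    have := h lam hl
    linarith
  have := topOrder_nonpos_of_forall_amplitude m (-E) (-W) h'
  linarith

/-- PARITY STEP (dominance of the `(𝔰-odd, 𝔭-even)` component). With
`(a,b,c,d) = (E₊₊, E₊₋, E₋₊, E₋₋)` the windowed top-order Euler rates of the four parity components
of the density, the data `u₀, -u₀, Pu₀, -Pu₀` give the four hypotheses; conclusion: `c ≤ 0` and
`c` dominates. -/
theorem dominance_of_four_parities (a b c d : ℝ)
    (h₁ : a + b + c + d ≤ 0) (h₂ : -a - b + c + d ≤ 0)
    (h₃ : a - b + c - d ≤ 0) (h₄ : -a + b + c - d ≤ 0) :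
    c ≤ 0 ∧ |a| ≤ -c ∧ |b| ≤ -c ∧ |d| ≤ -c := by
  refine ⟨by linarith, ?_, ?_, ?_⟩
  · rw [abs_le]; constructor <;> linarith
  · rw [abs_le]; constructor <;> linarith
  · rw [abs_le]; constructor <;> linarith

/-- Corollary for 𝔰-EVEN densities (`c = d = 0`: no 𝔰-odd component): all windowed top-order
Euler rates vanish, in particular the total one `a + b`. -/
theorem even_density_rates_vanish (a b : ℝ)
    (h₁ : a + b ≤ 0) (h₂ : -a - b ≤ 0) (h₃ : a - b ≤ 0) (h₄ : -a + b ≤ 0) :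
    a = 0 ∧ b = 0 := by
  have := dominance_of_four_parities a b 0 0 (by simpa using h₁) (by simpa using h₂)
    (by simpa using h₃) (by simpa using h₄)
  obtain ⟨-, ha, hb, -⟩ := this
  simp only [neg_zero] at ha hb
  exact ⟨abs_nonpos_iff.mp ha, abs_nonpos_iff.mp hb⟩

/-- CALCULUS SKELETON of PROPOSITION G: if `e` has derivative `e'` at `t₀ - r²`, then
`Θ_E(ρ) = ρ² e(t₀ - ρ²)` has derivative `2 r e(t₀ - r²) - 2 r³ e'` at `ρ = r`.
(With `e' = ∫(|u|²/2+p)u·∇Φ - ∫|∇u|²Φ` and `∇Φ = -(x-x₀)Φ/(2r²)` this is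
`r Θ_E' = 2Θ_E + 2Θ_D + Θ_F`.) -/
theorem scaledEnergy_hasDerivAt (e : ℝ → ℝ) (e' t₀ r : ℝ)
    (he : HasDerivAt e e' (t₀ - r ^ 2)) :
    HasDerivAt (fun ρ : ℝ => ρ ^ 2 * e (t₀ - ρ ^ 2))
      (2 * r * e (t₀ - r ^ 2) - 2 * r ^ 3 * e') r := by
  have h1 : HasDerivAt (fun ρ : ℝ => ρ ^ 2) (2 * r) r := by
    simpa using hasDerivAt_pow 2 r
  have h2 : HasDerivAt (fun ρ : ℝ => t₀ - ρ ^ 2) (-(2 * r)) r := by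
    simpa using h1.const_sub t₀
  have h3 : HasDerivAt (fun ρ : ℝ => e (t₀ - ρ ^ 2)) (e' * (-(2 * r))) r :=
    he.comp r h2
  have h4 := h1.mul h3
  refine h4.congr_deriv ?_
  ring

/-- The bookkeeping of COROLLARY G1: the identity/inequality `D ≥ 2Θ_E + 2Θ_D + Θ_F` for
`D = r Θ_E'` and the flux hypothesis `Θ_F ≥ -(2-δ)(Θ_E + Θ_D)` give `D ≥ δ (Θ_E + Θ_D)`. -/
theorem flux_criterion_step (D ΘE ΘD ΘF δ : ℝ)
    (hid : 2 * ΘE + 2 * ΘD + ΘF ≤ D) (hflux : -(2 - δ) * (ΘE + ΘD) ≤ ΘF) :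
    δ * (ΘE + ΘD) ≤ D := by
  nlinarith

/-- The interpolation arithmetic of COROLLARY G1/G2: for `Θ_E, Θ_D ≥ 0` and `K ≥ 1`,
`√(Θ_E Θ_D) + Θ_E / K ≤ (3/2)(Θ_E + Θ_D)` (so local `L³` smallness follows from `Θ_E + Θ_D → 0`,
and `L³` concentration forces `Θ_E + Θ_D ≳ γ²`). -/
theorem sqrt_mul_add_div_le (E D K : ℝ) (hE : 0 ≤ E) (hD : 0 ≤ D) (hK : 1 ≤ K) :
    Real.sqrt (E * D) + E / K ≤ (3 / 2) * (E + D) := by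
  have hs : Real.sqrt (E * D) ≤ (E + D) / 2 := by
    have hsq : Real.sqrt (E * D) ^ 2 = E * D := Real.sq_sqrt (mul_nonneg hE hD)
    nlinarith [Real.sqrt_nonneg (E * D), sq_nonneg (E - D),
      sq_nonneg (Real.sqrt (E * D) - (E + D) / 2)]
  have hdiv : E / K ≤ E := by
    rw [div_le_iff₀ (by linarith)]
    nlinarith
  linarith

end Summit.NavierStokesRegularity.NavierStokesRegularity.Theorems
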